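import Literature.AlgebraicGeometry.Resolution.NodalBlowupFormalChartsCodimTwo
import Mathlib.RingTheory.Ideal.Cotangent
import Mathlib.Algebra.Module.SpanRank
import HarnessLib

/-!
# Presentations of complete Noetherian local algebras by power series rings in
# `dim t*` variables (Mazur; Böckle Thm. 2.2 (c); Matsumura Thm. 8.4)

Topic `Literature/RingTheory/CompleteLocalRings`.  Let `Λ` be a complete local ring and `C` a
complete Noetherian local `Λ`-algebra whose structure map is local and induces a surjection on
residue fields (Mazur's category `Ĉ_Λ(k)`: "complete Noetherian local `Λ`-algebras with residue
field `k`").  Write `C̄ = C/𝔪_Λ C` for the *relative special fibre* and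
`h = μ(𝔪_{C̄}) = dim_k 𝔪_C/(𝔪_C² + 𝔪_Λ C)` for the minimal number of generators of its maximal
ideal — the dimension of the (relative) Zariski cotangent space, dual to Mazur's tangent space
`t_C = Hom_Λ(C, k[ε])`.  Then `C` is a quotient of the power series ring `Λ⟦X₁, …, X_h⟧` by a
`Λ`-algebra map sending the variables to lifts of generators of `𝔪_{C̄}`: B. Mazur, *Deforming
Galois representations* (1989), §1.2–1.6; G. Böckle, *Presentations of universal deformation
rings*, LMS LNS 320 (2007), Thm. 2.2 (c) ("`𝒪[[T₁, …, T_h]]`, `h = dim_k t_R`, the `Tᵢ` mapping to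
lifts of a basis of `𝔪_R/(𝔪_R² + 𝔪_𝒪 R)`"); the underlying commutative algebra is Matsumura,
*Commutative Ring Theory*, Thm. 8.4.  Everything is PROVED:

* `exists_mvPowerSeries_algHom_surjective_of_le_sup_sq` — if `x₁, …, x_r ∈ 𝔪_C` generate
  `𝔪_C` modulo `𝔪_Λ C + 𝔪_C²`, the substitution `Λ⟦X₁, …, X_r⟧ → C`, `Xᵢ ↦ xᵢ`, is a surjective
  `Λ`-algebra map (Nakayama + the tree's `exists_mvPowerSeries_ringHom_surjective_of_base`).
* `exists_mvPowerSeries_algHom_surjective_spanFinrank` — the same with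
  `r = h = μ(𝔪_{C/𝔪_Λ C})` variables.

## References

* G. Böckle, *Presentations of universal deformation rings*, LMS LNS 320 (2007), Thm. 2.2 (c).
  [cite: Bockle2007Presentations, Theorem 2.2]
* H. Matsumura, *Commutative Ring Theory*, CUP 1986, Thm. 8.4. [cite: Matsumura1987, Thm. 8.4]
-/

noncomputable section

namespace Literature.RingTheory.CompleteLocalRings

universe u

open IsLocalRing

variable {Λ : Type u} [CommRing Λ] [IsLocalRing Λ] {C : Type u} [CommRing C] [IsLocalRing C]
  [IsNoetherianRing C] [Algebra Λ C]

/-- **Nakayama for the relative cotangent space**: if `x₁, …, x_r` together with `𝔪_Λ C`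
generate `𝔪_C` modulo `𝔪_C²`, they generate `𝔪_C` modulo `𝔪_Λ C`. [cite: Matsumura1987, Thm. 8.4] -/
theorem maximalIdeal_le_span_sup_map_of_le_sup_sq {τ : Type*} (x : τ → C)
    (hgen : maximalIdeal C ≤ Ideal.span (Set.range x) ⊔
      (maximalIdeal Λ).map (algebraMap Λ C) ⊔ maximalIdeal C ^ 2) :
    maximalIdeal C ≤ Ideal.span (Set.range x) ⊔ (maximalIdeal Λ).map (algebraMap Λ C) := by
  refine Submodule.le_of_le_smul_of_le_jacobson_bot (IsNoetherian.noetherian _)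
    (IsLocalRing.maximalIdeal_le_jacobson ⊥) ?_
  rwa [smul_eq_mul, ← pow_two]

/-- **Power series presentations from cotangent generators** (Mazur; Böckle Thm. 2.2 (c);
Matsumura Thm. 8.4).  Let `Λ → C` be a local homomorphism of complete local rings, `C`
Noetherian, inducing a surjection on residue fields, and let `x₁, …, x_r ∈ 𝔪_C` generate `𝔪_C`
modulo `𝔪_Λ C + 𝔪_C²` (i.e. span the relative cotangent space `𝔪_C/(𝔪_C² + 𝔪_Λ C)`).  Then the
`Λ`-algebra map `Λ⟦X₁, …, X_r⟧ → C`, `Xᵢ ↦ xᵢ`, exists and is surjective.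
[cite: Bockle2007Presentations, Theorem 2.2] [cite: Matsumura1987, Thm. 8.4] -/
theorem exists_mvPowerSeries_algHom_surjective_of_le_sup_sq
    [IsAdicComplete (maximalIdeal Λ) Λ] [IsAdicComplete (maximalIdeal C) C]
    [IsLocalHom (algebraMap Λ C)]
    (hres : ∀ c : C, ∃ l : Λ, c - algebraMap Λ C l ∈ maximalIdeal C)
    {τ : Type} [Fintype τ] (x : τ → C) (hxm : ∀ i, x i ∈ maximalIdeal C)
    (hgen : maximalIdeal C ≤ Ideal.span (Set.range x) ⊔
      (maximalIdeal Λ).map (algebraMap Λ C) ⊔ maximalIdeal C ^ 2) :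
    ∃ Θ : MvPowerSeries τ Λ →ₐ[Λ] C, Function.Surjective Θ ∧ ∀ i, Θ (MvPowerSeries.X i) = x i := by
  obtain ⟨Θ, hΘX, hΘC, hsurj⟩ :=
    Literature.AlgebraicGeometry.Resolution.exists_mvPowerSeries_ringHom_surjective_of_base
      (algebraMap Λ C) hres x hxm (maximalIdeal_le_span_sup_map_of_le_sup_sq x hgen)
  refine ⟨{ Θ with commutes' := fun l => ?_ }, hsurj, hΘX⟩
  change Θ (algebraMap Λ (MvPowerSeries τ Λ) l) = algebraMap Λ C l
  rw [MvPowerSeries.algebraMap_apply, Algebra.algebraMap_self, RingHom.id_apply, hΘC]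

/-- **Presentation by `h = μ(𝔪_{C/𝔪_Λ C})` variables** (Mazur; Böckle Thm. 2.2 (c): "`R` is a
quotient of `𝒪[[T₁, …, T_h]]`, `h = dim_k t_R`").  With `Λ → C` as above and `h` the minimal
number of generators of the maximal ideal of the special fibre `C̄ = C/𝔪_Λ C` (equivalently
`dim_k 𝔪_C/(𝔪_C² + 𝔪_Λ C)`, Mathlib `spanFinrank_maximalIdeal_eq_finrank_cotangentSpace` for
`C̄`), there is a surjective `Λ`-algebra map `Λ⟦X₁, …, X_h⟧ → C` sending the variables into
`𝔪_C`. [cite: Bockle2007Presentations, Theorem 2.2] [cite: Matsumura1987, Thm. 8.4] -/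
theorem exists_mvPowerSeries_algHom_surjective_spanFinrank
    [IsAdicComplete (maximalIdeal Λ) Λ] [IsAdicComplete (maximalIdeal C) C]
    [IsLocalHom (algebraMap Λ C)]
    (hres : ∀ c : C, ∃ l : Λ, c - algebraMap Λ C l ∈ maximalIdeal C) :
    ∃ Θ : MvPowerSeries
        (Fin ((maximalIdeal C).map
          (Ideal.Quotient.mk ((maximalIdeal Λ).map (algebraMap Λ C)))).spanFinrank) Λ →ₐ[Λ] C,
      Function.Surjective Θ ∧ ∀ i, Θ (MvPowerSeries.X i) ∈ maximalIdeal C := by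
  classical
  set J : Ideal C := (maximalIdeal Λ).map (algebraMap Λ C) with hJ
  set π : C →+* C ⧸ J := Ideal.Quotient.mk J with hπ
  -- a minimal generating set of the image of `𝔪_C` in `C/J`
  have hfg : ((maximalIdeal C).map π).FG := Ideal.FG.map (IsNoetherian.noetherian _) π
  obtain ⟨s, hscard, hsspan⟩ := Submodule.FG.exists_span_set_encard_eq_spanFinrank hfg
  have hsfin : s.Finite := Set.finite_of_encard_eq_coe hscard
  obtain ⟨n, f, hf⟩ := hsfin.fin_embedding
  have hn : n = ((maximalIdeal C).map π).spanFinrank := by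
    have h1 : (Set.range f).encard = n := by
      rw [Set.encard_eq_coe_toFinset_card, Set.toFinset_range, Finset.card_image_of_injective _
        f.injective, Finset.card_univ, Fintype.card_fin]
    rw [hf, hscard] at h1
    exact_mod_cast h1.symm
  subst hn
  -- lift the generators to `𝔪_C`
  have hsub : s ⊆ ((maximalIdeal C).map π : Set (C ⧸ J)) := by
    rw [← hsspan]
    exact Submodule.subset_span
  have hlift : ∀ i, ∃ y ∈ maximalIdeal C, π y = f i := fun i => by
    have hfi : f i ∈ s := hf ▸ Set.mem_range_self i
    have hi : (f i : C ⧸ J) ∈ (maximalIdeal C).map π := hsub hfi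
    rw [Ideal.mem_map_iff_of_surjective π Ideal.Quotient.mk_surjective] at hi
    obtain ⟨y, hy, hyi⟩ := hi
    exact ⟨y, hy, hyi⟩
  choose x hxm hxf using hlift
  have hgen : maximalIdeal C ≤ Ideal.span (Set.range x) ⊔ J ⊔ maximalIdeal C ^ 2 := by
    intro m hm
    refine Ideal.mem_sup_left ?_
    have h1 : π m ∈ (Ideal.span (Set.range x)).map π := by
      have h2 : π m ∈ (maximalIdeal C).map π := Ideal.mem_map_of_mem _ hm
      rw [← hsspan, ← hf] at h2
      rw [Ideal.map_span, ← Set.range_comp]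
      have h3 : Set.range (⇑π ∘ x) = Set.range f := by
        ext z
        simp only [Set.mem_range, Function.comp_apply, hxf]
      rw [h3]
      exact h2
    rw [Ideal.mem_map_iff_of_surjective π Ideal.Quotient.mk_surjective] at h1
    obtain ⟨y, hy, hym⟩ := h1
    have h4 : m - y ∈ J := by
      rw [← Ideal.Quotient.mk_eq_mk_iff_sub_mem]
      exact hym.symm
    have h5 : m = y + (m - y) := by ring
    rw [h5]
    exact Ideal.add_mem _ (Ideal.mem_sup_left hy) (Ideal.mem_sup_right h4)
  obtain ⟨Θ, hsurj, hΘX⟩ :=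
    exists_mvPowerSeries_algHom_surjective_of_le_sup_sq hres x hxm hgen
  exact ⟨Θ, hsurj, fun i => (hΘX i).symm ▸ hxm i⟩

end Literature.RingTheory.CompleteLocalRings
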